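import Mathlib
import Summits.NavierStokesRegularity.NavierStokesRegularity.Theses.ConeTipCollapse
import HarnessLib

/-!
# `ConeTipCollapse.Assembly` — the route's assembly (item stmt-NavierStokesRegularity-19066; pure logic)

**Statement.** `CollapsingResolver → SkeletonRealisation → ClayUniqueness → ¬ NavierStokesRegularity`.

PROOF. Verbatim the `have hA : Assembly` block inside the route file's planner-authored, kernel-checked
deciding theorem `Theses.ConeTipCollapse.closes`: unpack the collapsing resolver, realise it as a
maximal smooth Leray–Hopf solution from a rapidly decaying datum (`SkeletonRealisation`), run Clay (A)
on the datum, glue by `ClayUniqueness` on `[0, T)`, and restrict the global solution to `[0, T + 1)`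
to contradict maximality.

HONEST FRAMING: glue between the route's own statements (about HYPOTHETICAL blow-ups); nothing
here bears on the regularity problem itself.
-/

noncomputable section

set_option linter.dupNamespace false

namespace Summit.NavierStokesRegularity.NavierStokesRegularity.Theorems

open Summit.NavierStokesRegularity.NavierStokesRegularity.Theses.ConeTipCollapse in
/-- **Item stmt-NavierStokesRegularity-19066** (`ConeTipCollapse.Assembly`): a collapsing resolver,
its realisation as a maximal smooth Leray–Hopf solution and Clay uniqueness refute
`NavierStokesRegularity` (the `hA` block of the route file's `closes`). [this file] -/
theorem coneTipCollapse_assembly_proof :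
    Summit.NavierStokesRegularity.NavierStokesRegularity.Theses.ConeTipCollapse.Assembly := by
  unfold Summit.NavierStokesRegularity.NavierStokesRegularity.Theses.ConeTipCollapse.Assembly
  rintro ⟨a, l₀, h, P, Q, Φ, b, W, q, hD⟩ h3 hu hReg
  obtain ⟨ν, hν, T, hT, u, p, ⟨hcl, hmax⟩, hLH, hdec, -, -⟩ := h3 a l₀ h P Q Φ b W q hD
  have h0 : (0 : ℝ) ∈ Set.Ico 0 T := ⟨le_rfl, hT⟩
  obtain ⟨u', p', hu', hp', hns, hbe⟩ :=
    hReg ν hν (u 0) (hcl.contDiff_velocity h0) (hcl.divFree 0 h0) hdec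
  have heq : ∀ t ∈ Set.Ico 0 T, u' t = u t :=
    hu ν hν (u 0) hdec u' u p' p T hT hu' hp' hns hbe hcl hLH rfl
  have hcl' : Literature.Analysis.FluidPDE.IsClassicalNSSolutionOn (Set.Ici 0) ν 0 u' p' :=
    ⟨hu', hp', fun t ht x => hns.momentum t ht x, fun t ht => hns.divFree t ht⟩
  refine hmax ⟨T + 1, by linarith, u', p', ?_, heq⟩
  exact hcl'.mono (fun t ht => ht.1) (uniqueDiffOn_Ico 0 (T + 1))

end Summit.NavierStokesRegularity.NavierStokesRegularity.Theorems

end
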